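import Mathlib
import Summits.RiemannHypothesis.RiemannHypothesis.Theorems.JensenPolynomialsDefs
import Summits.RiemannHypothesis.RiemannHypothesis.Theorems.JensenPolynomialsCumulantDefs
import Summits.RiemannHypothesis.RiemannHypothesis.Theses.JensenPolynomials
import Literature.NumberTheory.LFunctions.XiMoments

/-! # JensenCumulantSplit — PROVED GLUE of the split of the ANALYTIC crux `XiGorttwCoeffSmallAnalytic := XiGorttwCoeffSmallFrom rhoWinMin 10⁴`
(statements in `JensenPolynomialsCumulantDefs`) into
C0 (the cumulant identity `CumulantCoeffIdentity xiTaylorCoeff`: `c_{d,n,j} = (d)_j · e_j(Ũ₃(M),…,Ũ_j(M))`, `M = n + d`, pure algebra of the window of a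
positive sequence), C1 (THE ξ-statement `XiCumulantEnvelope A N`: `|Ũ_k(M)| ≤ A (k−1)! 2^{k/2} M^{−(k−2)/2}` — the `1/n!`-class envelope) and C2⁺
(`CumulantMajorantSum A ρ N`: ONE numeric sequence of all-plus majorant sums `< 1`), with the glue
`xiGorttwCoeffSmallFrom_rhoWinMin_of_split : 0 ≤ A → C0 → XiDeltaSqPos → C1(A,N) → C2⁺(A,rhoWinMin,N) → XiGorttwCoeffSmallFrom rhoWinMin N` PROVED.
RH-FREE (C0, C2⁺ are ξ-free; C1 is a statement about `γ` provable or refutable by unconditional asymptotics).  Verbatim port of HOME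
`rh-jensen-theory/JensenTargets.lean` v4.6 §8.10, §8.12 (cell rh-jensen, HUMAN RULING D-0040; THEORY-JENSEN.md §10.8; one file per source section, D-0064(4)).
This file is the Lean side of the foreseen tenure split `ledger route edit --split XiGorttwCoeffSmallAnalytic --into …` (route-prep/README §2). -/

noncomputable section
-- D-0017: `Summit.RiemannHypothesis.RiemannHypothesis.…` duplicates the namespace BY DESIGN (single-problem summit).
set_option linter.dupNamespace false

open Polynomial Finset
open scoped Nat

namespace Summit.RiemannHypothesis.RiemannHypothesis.Theorems.JensenPolynomials

open Literature.NumberTheory.LFunctions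

/-- **PROVED (kernel glue of the split, any table `ρ`, any `A`, any `N ≥ 0`):** `C0(ξ) → XiDeltaSqPos → C1 → C2 → S-C on n ≥ N`. -/
theorem xiGorttwCoeffSmallFrom_of_cumulantSplit {A : ℝ} {ρ : ℕ → ℕ → ℝ} {N : ℕ}
    (hId : CumulantCoeffIdentity xiTaylorCoeff) (hΔ : XiDeltaSqPos)
    (h1 : XiCumulantEnvelope A N) (h2 : CumulantEnvelopeSum A ρ N) : XiGorttwCoeffSmallFrom ρ N := by
  intro d n hd hn hNn
  have hpos : ∀ m, 0 < xiTaylorCoeff m := xiTaylorCoeff_pos_holds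
  have hΔM : 0 < gorttwDeltaSq xiTaylorCoeff (n + d) := hΔ (n + d) (by omega)
  have hγ0 : xiTaylorCoeff (n + d) ≠ 0 := (hpos _).ne'
  have hγ1 : xiTaylorCoeff (n + d - 1) ≠ 0 := (hpos _).ne'
  set U : ℕ → ℝ := hermiteCumulant xiTaylorCoeff (n + d) with hU
  have hd3 : 0 < d := by omega
  have henv : ∀ k : ℕ, 3 ≤ k → k ≤ d →
      |U k| ≤ A * ((k - 1)! : ℝ) * (2 : ℝ) ^ ((k : ℝ) / 2) / ((n + d : ℕ) : ℝ) ^ (((k : ℝ) - 2) / 2) := by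
    intro k hk3 hkd
    have hNM : N ≤ n + d := by omega
    have hk : 2 * k ^ 3 < n + d := by
      have : k ^ 3 ≤ d ^ 3 := Nat.pow_le_pow_left hkd 3
      omega
    exact h1 (n + d) k hNM hk3 hk
  have key : ∀ j ∈ range d, |gorttwCoeff xiTaylorCoeff d n (j + 1)| =
      (d.descFactorial (j + 1) : ℝ) * |cumulantCoeff U (j + 1)| := by
    intro j hj
    rw [Finset.mem_range] at hj
    rw [hId d n (j + 1) hd (by omega) hΔM hγ0 hγ1, abs_mul, Nat.abs_cast]
  obtain ⟨hA, hB⟩ := h2 d n U hd hn hNn henv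
  refine ⟨?_, ?_⟩
  · calc ∑ j ∈ range d, |gorttwCoeff xiTaylorCoeff d n (j + 1)| * ρ d (j + 1)
        = ∑ j ∈ range d, (d.descFactorial (j + 1) : ℝ) * |cumulantCoeff U (j + 1)| * ρ d (j + 1) :=
          Finset.sum_congr rfl (fun j hj => by rw [key j hj])
      _ < 1 := hA
  · calc ∑ j ∈ range d, |gorttwCoeff xiTaylorCoeff d n (j + 1)| * (2 / hermiteTestBound d) ^ (j + 1)
        = ∑ j ∈ range d, (d.descFactorial (j + 1) : ℝ) * |cumulantCoeff U (j + 1)| *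
            (2 / hermiteTestBound d) ^ (j + 1) :=
          Finset.sum_congr rfl (fun j hj => by rw [key j hj])
      _ < 1 := hB

/-- The equation lemma of `cumulantCoeff` at a successor. -/
theorem cumulantCoeff_succ (U : ℕ → ℝ) (j : ℕ) : cumulantCoeff U (j + 1) =
    (∑ i : Fin (j + 1), (if 2 ≤ i.1 then U (i.1 + 1) / ((i.1)! : ℝ) * cumulantCoeff U (j - i.1) else 0)) /
      ((j : ℝ) + 1) := by
  rw [cumulantCoeff]

/-- **Majorisation (PROVED): `|U_k| ≤ V_k` for `3 ≤ k ≤ J` implies `|e_j(U)| ≤ e_j(V)` and `0 ≤ e_j(V)` for `j ≤ J`.** -/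
theorem cumulantCoeff_abs_le (U V : ℕ → ℝ) (J : ℕ) (hUV : ∀ k, 3 ≤ k → k ≤ J → |U k| ≤ V k) :
    ∀ j, j ≤ J → |cumulantCoeff U j| ≤ cumulantCoeff V j ∧ 0 ≤ cumulantCoeff V j := by
  intro j
  induction j using Nat.strong_induction_on with
  | _ j ih =>
    intro hj
    cases j with
    | zero => simp [cumulantCoeff]
    | succ j =>
      rw [cumulantCoeff_succ U j, cumulantCoeff_succ V j]
      have hj1 : (0 : ℝ) < (j : ℝ) + 1 := by positivity
      have key : ∀ i : Fin (j + 1),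
          |(if 2 ≤ i.1 then U (i.1 + 1) / ((i.1)! : ℝ) * cumulantCoeff U (j - i.1) else 0)| ≤
            (if 2 ≤ i.1 then V (i.1 + 1) / ((i.1)! : ℝ) * cumulantCoeff V (j - i.1) else 0) ∧
          0 ≤ (if 2 ≤ i.1 then V (i.1 + 1) / ((i.1)! : ℝ) * cumulantCoeff V (j - i.1) else 0) := by
        intro i
        by_cases h2 : 2 ≤ i.1
        · simp only [if_pos h2]
          have hi := i.2
          obtain ⟨hle, hnn⟩ := ih (j - i.1) (by omega) (by omega)
          have hU := hUV (i.1 + 1) (by omega) (by omega)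
          have hV0 : 0 ≤ V (i.1 + 1) := le_trans (abs_nonneg _) hU
          have hf : (0 : ℝ) < ((i.1)! : ℝ) := by positivity
          refine ⟨?_, mul_nonneg (div_nonneg hV0 hf.le) hnn⟩
          rw [abs_mul, abs_div, Nat.abs_cast]
          exact mul_le_mul (div_le_div_of_nonneg_right hU hf.le) hle (abs_nonneg _) (div_nonneg hV0 hf.le)
        · simp only [if_neg h2, abs_zero]; exact ⟨le_rfl, le_rfl⟩
      constructor
      · rw [abs_div, abs_of_pos hj1]
        apply div_le_div_of_nonneg_right _ hj1.le
        exact (Finset.abs_sum_le_sum_abs _ _).trans (Finset.sum_le_sum (fun i _ => (key i).1))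
      · exact div_nonneg (Finset.sum_nonneg (fun i _ => (key i).2)) hj1.le

/-- `envCap A M k ≥ 0` for `A ≥ 0`. -/
theorem envCap_nonneg {A : ℝ} (hA : 0 ≤ A) (M k : ℕ) : 0 ≤ envCap A M k := by
  unfold envCap; positivity

/-- The caps DEcrease in `M` (for `k ≥ 2`, `A ≥ 0`, `M ≥ 1`). -/
theorem envCap_antitone {A : ℝ} (hA : 0 ≤ A) {M M' k : ℕ} (hM : 1 ≤ M) (hMM : M ≤ M') (hk : 2 ≤ k) :
    envCap A M' k ≤ envCap A M k := by
  unfold envCap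
  have hnum : 0 ≤ A * ((k - 1)! : ℝ) * (2 : ℝ) ^ ((k : ℝ) / 2) := by positivity
  have he : 0 ≤ ((k : ℝ) - 2) / 2 := by
    have : (2 : ℝ) ≤ k := by exact_mod_cast hk
    linarith
  have hMpos : (0 : ℝ) < (M : ℝ) := by exact_mod_cast hM
  have hpow : (0 : ℝ) < (M : ℝ) ^ (((k : ℝ) - 2) / 2) := Real.rpow_pos_of_pos hMpos _
  have hle : (M : ℝ) ^ (((k : ℝ) - 2) / 2) ≤ (M' : ℝ) ^ (((k : ℝ) - 2) / 2) :=
    Real.rpow_le_rpow hMpos.le (by exact_mod_cast hMM) he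
  exact div_le_div_of_nonneg_left hnum hpow hle

/-- **PROVED: C2⁺ → C2** (for `A ≥ 0` and a nonnegative table). -/
theorem cumulantEnvelopeSum_of_majorant {A : ℝ} {ρ : ℕ → ℕ → ℝ} {N : ℕ} (hA : 0 ≤ A)
    (hρ : ∀ d j, 3 ≤ d → 1 ≤ j → j ≤ d → 0 ≤ ρ d j) (h : CumulantMajorantSum A ρ N) :
    CumulantEnvelopeSum A ρ N := by
  intro d n U hd hn hN hU
  obtain ⟨h1, h2⟩ := h d hd
  set M0 : ℕ := max N (2 * d ^ 3) + d with hM0def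
  have hM0 : M0 ≤ n + d := by
    have : max N (2 * d ^ 3) ≤ n := max_le hN hn
    omega
  have hM0pos : 1 ≤ M0 := by omega
  have hcapU : ∀ k, 3 ≤ k → k ≤ d → |U k| ≤ envCap A (n + d) k := fun k hk hkd => hU k hk hkd
  have hcapmono : ∀ k, 3 ≤ k → k ≤ d → |envCap A (n + d) k| ≤ envCap A M0 k := by
    intro k hk _
    rw [abs_of_nonneg (envCap_nonneg hA _ _)]
    exact envCap_antitone hA hM0pos hM0 (by omega)
  have hterm : ∀ j ∈ range d, |cumulantCoeff U (j + 1)| ≤ cumulantCoeff (envCap A M0) (j + 1) := by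
    intro j hj
    have hjd : j + 1 ≤ d := by have := mem_range.1 hj; omega
    obtain ⟨hle1, -⟩ := cumulantCoeff_abs_le U (envCap A (n + d)) d hcapU (j + 1) hjd
    obtain ⟨hle2, -⟩ := cumulantCoeff_abs_le (envCap A (n + d)) (envCap A M0) d hcapmono (j + 1) hjd
    exact hle1.trans ((le_abs_self _).trans hle2)
  have hB : 0 ≤ 2 / hermiteTestBound d := div_nonneg (by norm_num) (by unfold hermiteTestBound; positivity : (0:ℝ) < hermiteTestBound d).le
  constructor
  · refine lt_of_le_of_lt (Finset.sum_le_sum (fun j hj => ?_)) h1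
    exact mul_le_mul_of_nonneg_right (mul_le_mul_of_nonneg_left (hterm j hj) (Nat.cast_nonneg _))
      (hρ d (j + 1) hd (by omega) (by have := mem_range.1 hj; omega))
  · refine lt_of_le_of_lt (Finset.sum_le_sum (fun j hj => ?_)) h2
    exact mul_le_mul_of_nonneg_right (mul_le_mul_of_nonneg_left (hterm j hj) (Nat.cast_nonneg _)) (pow_nonneg hB _)

/-- The route's tables are nonnegative on `3 ≤ d` (needed for C2⁺ → C2). -/
theorem rhoHT_nonneg (d j : ℕ) (hd : 3 ≤ d) : 0 ≤ rhoHT d j := by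
  unfold rhoHT
  have h3 : (3 : ℝ) ≤ d := by exact_mod_cast hd
  have h1 : (0 : ℝ) ≤ (d : ℝ) - 1 := by linarith
  have h2 : (0 : ℝ) ≤ (d : ℝ) - 2 := by linarith
  have h3' : (0 : ℝ) ≤ (d : ℝ) - 3 := by linarith
  split_ifs
  · exact le_rfl
  · exact div_nonneg (by norm_num) (by positivity)
  · exact div_nonneg (Real.sqrt_nonneg _) (by positivity)
  · exact div_nonneg (by positivity) (by positivity)
  · exact Real.sqrt_nonneg _

/-- The window table is nonnegative (`3 ≤ d`, `1 ≤ j`). -/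
theorem rhoWin_nonneg (d j : ℕ) (hd : 3 ≤ d) (hj : 1 ≤ j) : 0 ≤ rhoWin d j := by
  unfold rhoWin
  have hj' : (0 : ℝ) ≤ (j : ℝ) - 1 := by
    have : (1 : ℝ) ≤ j := by exact_mod_cast hj
    linarith
  split_ifs
  · exact rhoHT_nonneg d j hd
  · positivity
  · exact rhoHT_nonneg d j hd

/-- `bndRow5 d ≥ 0` for `d ≥ 8`. -/
theorem bndRow5_nonneg {d : ℝ} (hd : 8 ≤ d) : 0 ≤ bndRow5 d := by
  unfold bndRow5
  have h1 : 0 < d - 1 := by linarith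
  have h2 : 0 < d - 2 := by linarith
  have h3 : 0 < d - 3 := by linarith
  have h4 : 0 < d - 4 := by linarith
  positivity

/-- `bndRow6 d ≥ 0` for `d ≥ 9`. -/
theorem bndRow6_nonneg {d : ℝ} (hd : 9 ≤ d) : 0 ≤ bndRow6 d := by
  unfold bndRow6
  have h1 : 0 < d - 1 := by linarith
  have h2 : 0 < d - 2 := by linarith
  have h3 : 0 < d - 3 := by linarith
  have h4 : 0 < d - 4 := by linarith
  have h5 : 0 < d - 5 := by linarith
  positivity

/-- The route's table `rhoWinMin` is nonnegative (`3 ≤ d`, `1 ≤ j`). -/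
theorem rhoWinMin_nonneg (d j : ℕ) (hd : 3 ≤ d) (hj : 1 ≤ j) : 0 ≤ rhoWinMin d j := by
  unfold rhoWinMin
  have hj' : (0 : ℝ) ≤ (j : ℝ) - 1 := by
    have : (1 : ℝ) ≤ j := by exact_mod_cast hj
    linarith
  split_ifs with h4 h5 h6 hw
  · exact rhoHT_nonneg d j hd
  · have : (8 : ℝ) ≤ d := by exact_mod_cast h5.2
    exact le_min (rhoHT_nonneg d j hd) (div_nonneg (bndRow5_nonneg this) (by positivity))
  · have : (9 : ℝ) ≤ d := by exact_mod_cast h6.2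
    exact le_min (rhoHT_nonneg d j hd) (div_nonneg (bndRow6_nonneg this) (by positivity))
  · positivity
  · exact rhoHT_nonneg d j hd

/-- **THE ROUTE'S ANALYTIC CRUX IN SPLIT FORM (PROVED glue, HOME): `C0(ξ) → XiDeltaSqPos → C1(A, N) → C2⁺(A, ρ, N) → S-C on n ≥ N`**
for any `A ≥ 0` and any table nonnegative on `3 ≤ d`, `1 ≤ j ≤ d` (`rhoWin`, `rhoWinMin`, `rhoWinPlus`, `rhoHT`).  With `ρ = rhoWin`,
`N = 10⁴` the conclusion is literally the route's crux `XiGorttwCoeffSmallAnalytic`; C2⁺ is ONE explicit sequence of numbers `< 1`. -/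
theorem xiGorttwCoeffSmallFrom_of_split {A : ℝ} {ρ : ℕ → ℕ → ℝ} {N : ℕ} (hA : 0 ≤ A)
    (hρ : ∀ d j, 3 ≤ d → 1 ≤ j → j ≤ d → 0 ≤ ρ d j)
    (hId : CumulantCoeffIdentity xiTaylorCoeff) (hΔ : XiDeltaSqPos)
    (h1 : XiCumulantEnvelope A N) (h2 : CumulantMajorantSum A ρ N) : XiGorttwCoeffSmallFrom ρ N :=
  xiGorttwCoeffSmallFrom_of_cumulantSplit hId hΔ h1 (cumulantEnvelopeSum_of_majorant hA hρ h2)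

/-- The split glue at the window table `rhoWin`. -/
theorem xiGorttwCoeffSmallFrom_rhoWin_of_split {A : ℝ} {N : ℕ} (hA : 0 ≤ A)
    (hId : CumulantCoeffIdentity xiTaylorCoeff) (hΔ : XiDeltaSqPos)
    (h1 : XiCumulantEnvelope A N) (h2 : CumulantMajorantSum A rhoWin N) : XiGorttwCoeffSmallFrom rhoWin N :=
  xiGorttwCoeffSmallFrom_of_split hA (fun d j hd hj _ => rhoWin_nonneg d j hd hj) hId hΔ h1 h2

/-- The split glue at the route's table `rhoWinMin`: `0 ≤ A → C0(ξ) → XiDeltaSqPos → C1(A,N) → C2⁺(A,rhoWinMin,N) → XiGorttwCoeffSmallFrom rhoWinMin N`. -/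
theorem xiGorttwCoeffSmallFrom_rhoWinMin_of_split {A : ℝ} {N : ℕ} (hA : 0 ≤ A)
    (hId : CumulantCoeffIdentity xiTaylorCoeff) (hΔ : XiDeltaSqPos)
    (h1 : XiCumulantEnvelope A N) (h2 : CumulantMajorantSum A rhoWinMin N) : XiGorttwCoeffSmallFrom rhoWinMin N :=
  xiGorttwCoeffSmallFrom_of_split hA (fun d j hd hj _ => rhoWinMin_nonneg d j hd hj) hId hΔ h1 h2

/-! ## THE ROUTE'S SPLIT GLUE, CONCRETE (A = 17/16, N = 10⁴, table `rhoWinMin`; PROVED): the foreseen tenure split of the analytic crux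
`XiGorttwCoeffSmallAnalytic := XiGorttwCoeffSmallFrom rhoWinMin 10000` into C0 / C1 / C2⁺ (+ the route's support item `XiDeltaSqPos`). -/

/-- C0 ∧ XiDeltaSqPos ∧ C1(17/16, 10⁴) ∧ C2⁺(17/16, rhoWinMin, 10⁴) ⟹ the ANALYTIC crux. -/
theorem xiGorttwCoeffSmallAnalytic_of_split (h0 : CumulantCoeffIdentity xiTaylorCoeff) (hΔ : XiDeltaSqPos)
    (h1 : XiCumulantEnvelope (17 / 16) 10000) (h2 : CumulantMajorantSum (17 / 16) rhoWinMin 10000) :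
    XiGorttwCoeffSmallFrom rhoWinMin 10000 :=
  xiGorttwCoeffSmallFrom_rhoWinMin_of_split (by norm_num) h0 hΔ h1 h2

/-! ## ITEM CLOSER (route `JensenPolynomials`; the Theses decl is this statement by definition). -/

/-- After the tenure split (README §2): the split's GLUE item, children `XiCumulantIdentity := CumulantCoeffIdentity xiTaylorCoeff`,
`XiCumulantEnvelope1716 := XiCumulantEnvelope (17/16) 10000`, `XiCumulantMajorant := CumulantMajorantSum (17/16) rhoWinMin 10000` + the existing support
`XiDeltaSqPos`; until the split is filed this theorem is stated over the Defs-level statements (definitionally the same). -/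
theorem xiGorttwCoeffSmallAnalytic_glue (h0 : CumulantCoeffIdentity xiTaylorCoeff) (hΔ : XiDeltaSqPos)
    (h1 : XiCumulantEnvelope (17 / 16) 10000) (h2 : CumulantMajorantSum (17 / 16) rhoWinMin 10000) :
    Summit.RiemannHypothesis.RiemannHypothesis.Theses.JensenPolynomials.XiGorttwCoeffSmallAnalytic :=
  xiGorttwCoeffSmallAnalytic_of_split h0 hΔ h1 h2

end Summit.RiemannHypothesis.RiemannHypothesis.Theorems.JensenPolynomials

end
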